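/-
Copyright: the b2b-balaban cell (near-miss cell 7), T⁴-continuum fan-out, lineage t4-ne7b-p3 (node U5c LARGE-DEVIATION
member P3).  Released under the licence of the surrounding project.
-/
import Summits.QuantumFields.BalabanUV.T4Continuum.Support.ZoneTorus
import Summits.QuantumFields.BalabanUV.T4Continuum.Support.SpaceTimeAnimals

/-!
# Space-time Peierls ∕ Cramér route for NE7b — leaf A2a: the SPACE-TIME CELL GRAPH on the cutoff-`K` torus, its
# degree bound `3^d + L^d + 1`, the anchor count `n^d`, and the animal count through a cell (A1 applied)

Summits-side support leaf of the T⁴-continuum cell (rung (B)+1 on a FINITE torus only; NOT infinite volume, NOT the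
mass gap, NOT the Clay statement; NOT a proof of the spine estimate NE7b).  Lineage `t4-ne7b-p3` (generation 1), node
U5c, skeleton `t4/skeletons/NE7b-t4-ne7b-p3.md` v1.2 leaf A2a (row ST2).  [folklore] finite combinatorics on the cell
model of `Support/ZoneTorus.lean` (lineage t4-ne7b-p1: `TCell`, `IsScale`, `cellsAt`, `nearT`, `card_nearT_le`),
imported BY NAME; nothing is quoted from print and nothing printed is asserted; no `[cite:]` tag.

THE MODEL (uniform blocking by `L` per step, as in `ZoneTorus`; the size-ratio excess of non-uniform blockings is the
located item of that file and stays with the (ID) owners).  A SPACE-TIME CELL of the cutoff-`K` run is a pair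
(scale `s ≤ K`, cell of scale `s` of the fine torus `(ℤ∕nL^K)^d`) — `STCell d n L K`.  Two cells are ADJACENT
(`stGraph`) when they are of the same scale with level-`s` blocks at cyclic sup-distance `≤ 1` (LATERAL: «intersect, or
touch each other»), or when one is of the next scale and its level-`(s+1)` block contains the other's (VERTICAL: the
parent ∕ child relation of the nesting).
* §1 `STCell`, `stRel`, `stGraph` (`SimpleGraph.fromRel`).
* §2 **`degree_stGraph_le`**: every degree is `≤ 3^d + L^d + 1` (lateral `≤ NZT d L 1 s s = 3^d`, parent `≤ 1`,
  children `≤ L^d`, by `ZoneTorus.card_nearT_le` ∕ `card_nearT_le'`) — uniformly in `n`, `K` and the cell.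
* §3 `card_anchors_le`: the cells of the final scale `K` number `≤ n^d` (`ZoneTorus.card_cellsAt`).
* §4 **`card_animals_stGraph_le`**: leaf A1 (`SpaceTimeAnimals.siteAnimalBound_sq`) APPLIED — the connected cell sets
  of size `m` through a given space-time cell number `≤ ((3^d + L^d + 2)²)^m`, uniformly in `n`, `K`.
So the END's entropy binders (`OccLeaves`: a degree bound with `SiteAnimalBound`, anchors `≤ Nanc`) are DISCHARGED on
the cell model with `Δ = 3^d + L^d + 1`, `Δ₁ = (Δ+1)²`, `Nanc = n^d`; what remains displayed on the occupancy side is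
the reading A2b (which cells a term's live lineage occupies) and the cover A2c over it.

HONEST DEPENDENCY (cell, verbatim): continuum YM on T⁴ ⇐ BetaPertH ∧ nine spine estimates (0/9 proved); BetaPertH ⇐
(D1) ∧ (D4) ∧ CAP+tail; G-an2-4 gates asym, D1 and NE2/3/4.  This file changes none of it.
-/

open Finset

namespace Summit.QuantumFields.BalabanUV.T4Continuum.SpaceTimePeierls

open Summit.QuantumFields.BalabanUV.T4Continuum.ZoneTorus SpaceTimePeierlsLeaves

open scoped Classical

noncomputable section

/-! ## §1 Space-time cells and their adjacency -/

/-- SPACE-TIME CELLS of the cutoff-`K` run on the torus of `n` unit cells a side: a scale `s ≤ K` and a cell of scale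
`s` (coordinates multiples of `L^s`) of the fine torus `(ℤ∕nL^K)^d`. [folklore] -/
abbrev STCell (d n L K : ℕ) := {p : Fin (K + 1) × TCell d (n * L ^ K) // IsScale L p.1.val p.2}

variable {d n L K : ℕ}

/-- the scale of a space-time cell [folklore] -/
abbrev STCell.sc (v : STCell d n L K) : ℕ := v.1.1.val

/-- the underlying torus cell [folklore] -/
abbrev STCell.pt (v : STCell d n L K) : TCell d (n * L ^ K) := v.1.2

variable (d n L K) in
/-- the generating relation: LATERAL (same scale, level-`s` blocks at cyclic sup-distance `≤ 1`) or VERTICAL (`w` is the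
parent of `v`: next scale, `w`'s level-`(s+1)` block contains `v`). [folklore] -/
def stRel (v w : STCell d n L K) : Prop :=
  (v.sc = w.sc ∧ nearT n L K v.pt v.sc w.pt w.sc v.sc 1) ∨ (v.sc + 1 = w.sc ∧ nearT n L K v.pt v.sc w.pt w.sc w.sc 0)

variable (d n L K) in
/-- THE SPACE-TIME CELL GRAPH (symmetric closure of `stRel`, loops removed). [folklore] -/
def stGraph : SimpleGraph (STCell d n L K) := SimpleGraph.fromRel (stRel d n L K)

/-! ## §2 The degree bound -/

/-- two space-time cells with the same scale and the same torus cell are equal [folklore] -/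
theorem STCell.ext_of {v w : STCell d n L K} (hs : v.sc = w.sc) (hp : v.pt = w.pt) : v = w := by
  apply Subtype.ext
  apply Prod.ext
  · exact Fin.ext hs
  · exact hp

/-- the cells of a given scale `s` whose torus cell satisfies `P` inject (by `pt`) into the torus cells satisfying `P`
[folklore] -/
theorem card_filter_scale_le (s : ℕ) (P : TCell d (n * L ^ K) → Prop) :
    ((univ : Finset (STCell d n L K)).filter fun w => w.sc = s ∧ P w.pt).card
      ≤ ((univ : Finset (TCell d (n * L ^ K))).filter P).card := by
  refine card_le_card_of_injOn (fun w => w.pt) (fun w hw => ?_) (fun w₁ hw₁ w₂ hw₂ h => ?_)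
  · have := (mem_filter.1 (mem_coe.1 hw)).2
    exact mem_coe.2 (mem_filter.2 ⟨mem_univ _, this.2⟩)
  · have h1 := (mem_filter.1 (mem_coe.1 hw₁)).2.1
    have h2 := (mem_filter.1 (mem_coe.1 hw₂)).2.1
    exact STCell.ext_of (h1.trans h2.symm) h

/-- **THE DEGREE BOUND**: every space-time cell has at most `3^d` lateral neighbours, at most one parent and at most
`L^d` children: `degree ≤ 3^d + L^d + 1`, uniformly in `n`, `K` and the cell (`L ≥ 1`). [folklore] -/
theorem degree_stGraph_le (hL : 1 ≤ L) (v : STCell d n L K) : (stGraph d n L K).degree v ≤ 3 ^ d + L ^ d + 1 := by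
  rw [← SimpleGraph.card_neighborFinset_eq_degree, SimpleGraph.neighborFinset_eq_filter]
  -- the three families
  set Lat := (univ : Finset (STCell d n L K)).filter fun w => w.sc = v.sc ∧ nearT n L K v.pt v.sc w.pt v.sc v.sc 1
    with hLat
  set Up := (univ : Finset (STCell d n L K)).filter fun w =>
      w.sc = v.sc + 1 ∧ nearT n L K v.pt v.sc w.pt (v.sc + 1) (v.sc + 1) 0 with hUp
  set Dn := (univ : Finset (STCell d n L K)).filter fun w =>
      w.sc = v.sc - 1 ∧ nearT n L K w.pt (v.sc - 1) v.pt v.sc v.sc 0 with hDn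
  have hsub : ((univ : Finset (STCell d n L K)).filter fun w => (stGraph d n L K).Adj v w) ⊆ Lat ∪ (Up ∪ Dn) := by
    intro w hw
    have hadj := (mem_filter.1 hw).2
    rw [stGraph, SimpleGraph.fromRel_adj] at hadj
    obtain ⟨_, h | h⟩ := hadj
    · rcases h with ⟨hs, hn⟩ | ⟨hs, hn⟩
      · refine mem_union_left _ (mem_filter.2 ⟨mem_univ _, hs.symm, ?_⟩)
        rw [← hs] at hn; exact hn
      · refine mem_union_right _ (mem_union_left _ (mem_filter.2 ⟨mem_univ _, hs.symm, ?_⟩))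
        rw [hs]; exact hn
    · rcases h with ⟨hs, hn⟩ | ⟨hs, hn⟩
      · refine mem_union_left _ (mem_filter.2 ⟨mem_univ _, hs, ?_⟩)
        have h' := (nearT_comm n L K v.pt v.sc w.pt w.sc w.sc 1).2 hn
        rw [hs] at h'; exact h'
      · refine mem_union_right _ (mem_union_right _ (mem_filter.2 ⟨mem_univ _, by omega, ?_⟩))
        have h1 : v.sc - 1 = w.sc := by omega
        rw [h1]; exact hn
  have hLat' : Lat.card ≤ 3 ^ d := by
    refine (card_filter_scale_le v.sc _).trans ((card_nearT_le n hL K v.pt v.sc v.sc v.sc 1).trans ?_)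
    simp [NZT]
  have hUp' : Up.card ≤ 1 := by
    refine (card_filter_scale_le (v.sc + 1) _).trans
      ((card_nearT_le n hL K v.pt v.sc (v.sc + 1) (v.sc + 1) 0).trans ?_)
    simp [NZT]
  have hDn' : Dn.card ≤ L ^ d := by
    refine (card_filter_scale_le (v.sc - 1) _).trans
      ((card_nearT_le' n hL K v.pt (v.sc - 1) v.sc v.sc 0).trans ?_)
    simp only [NZT, Nat.floor_zero, mul_zero, zero_add, one_pow, one_mul]
    calc (L ^ d) ^ (v.sc - (v.sc - 1)) ≤ (L ^ d) ^ 1 := pow_le_pow_right₀ (Nat.one_le_pow _ _ hL) (by omega)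
      _ = L ^ d := pow_one _
  calc ((univ : Finset (STCell d n L K)).filter fun w => (stGraph d n L K).Adj v w).card
      ≤ (Lat ∪ (Up ∪ Dn)).card := card_le_card hsub
    _ ≤ Lat.card + (Up.card + Dn.card) := (card_union_le _ _).trans (Nat.add_le_add_left (card_union_le _ _) _)
    _ ≤ 3 ^ d + (1 + L ^ d) := Nat.add_le_add hLat' (Nat.add_le_add hUp' hDn')
    _ = 3 ^ d + L ^ d + 1 := by ring

/-! ## §3 Anchors: the cells of the final scale -/

/-- the space-time cells of the final scale `K` number at most `n^d` (the unit cells of the torus). [folklore] -/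
theorem card_anchors_le (hL : 1 ≤ L) :
    ((univ : Finset (STCell d n L K)).filter fun w => w.sc = K).card ≤ n ^ d := by
  have h := card_filter_scale_le (d := d) (n := n) (L := L) (K := K) K (IsScale L K)
  have hset : ((univ : Finset (STCell d n L K)).filter fun w => w.sc = K)
      = (univ : Finset (STCell d n L K)).filter fun w => w.sc = K ∧ IsScale L K w.pt := by
    refine filter_congr fun w _ => ⟨fun hw => ⟨hw, ?_⟩, fun hw => hw.1⟩
    have := w.2
    rw [show w.1.1.val = K from hw] at this
    exact this
  rw [hset]
  refine h.trans ?_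
  have hc := card_cellsAt (d := d) n hL (le_refl K)
  rw [Nat.sub_self, pow_zero, mul_one] at hc
  rw [cellsAt] at hc
  exact hc.le

/-! ## §4 Leaf A1 applied: animals through a space-time cell -/

/-- **ANIMALS ON THE SPACE-TIME CELL GRAPH**: the connected cell sets of size `m` through a given cell number at most
`((3^d + L^d + 2)²)^m`, uniformly in `n` and `K` (`SpaceTimeAnimals.siteAnimalBound_sq` at `Δ = 3^d + L^d + 1`).
[folklore] -/
theorem card_animals_stGraph_le (hL : 1 ≤ L) (v : STCell d n L K) (m : ℕ) :
    (Nat.card {S : Finset (STCell d n L K) //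
        v ∈ S ∧ S.card = m ∧ ((stGraph d n L K).induce (S : Set (STCell d n L K))).Connected} : ℝ)
      ≤ ((((3 ^ d + L ^ d + 1 : ℕ) : ℝ) + 1) ^ 2) ^ m :=
  siteAnimalBound_sq (3 ^ d + L ^ d + 1) (STCell d n L K) (stGraph d n L K) (degree_stGraph_le hL) v m

end

end Summit.QuantumFields.BalabanUV.T4Continuum.SpaceTimePeierls
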